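import Mathlib
import Summits.Parity.GeneralizedHardyLittlewood.Theorems.FordMaynardSieveConst01651SieveConst01651SquareDivisorCount

/-!
# Route `FordMaynardSieveConst01651`, target `SieveConst01651` (stmt-Parity-19185), line `sieve_decomposition`:
# helpers towards `stub_typeIIRegion` — counting the exceptional pairs `(q, n'')`

The count term `#{(q, n'') ∈ W × [1, x] : x/2 < q n'' ≤ x, R(q, n''), Q(n'')}` of `typeII_abs_mass_minFac_le`
(…TypeIIDiscard) / `bilin_abs_mass_le` (…BilinMass) is at most `∑_{q ∈ W} #{n'' ≤ ⌊x⌋/q : Q(n'')}`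
(`card_pairs_window_le`), hence, for `Q(n'') = [∃ p > Y prime, p² ∣ n'']`, at most
`(2x/(Y+1)) ∑_{q ∈ W} 1/q` (`card_pairs_window_sq_le`, via …SquareDivisorCount) — `≪ x^{1−ν} log x` for
`Y ≍ x^ν`, `W ⊆ [1, x^ν]`, negligible against the factor `2M = 2x^{ν/10}` from (w).
[Ford–Maynard, arXiv:2407.14368v1, §7 (discarding exceptional sets); folklore counting.]
Def-free. Nothing here proves anything about the Parity summit.
-/

open Finset

namespace Summit.Parity.GeneralizedHardyLittlewood.FordMaynardSieveConst01651SieveConst01651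

/-- `#{(q, n'') ∈ W × [1, ⌊x⌋] : x/2 < q n'' ≤ x, R(q,n''), Q(n'')} ≤ ∑_{q ∈ W} #{n'' ∈ [1, ⌊x⌋/q] : Q(n'')}`
(`q ≥ 1` on `W`). [folklore] -/
theorem card_pairs_window_le {x : ℝ} (W : Finset ℕ) (hW : ∀ q ∈ W, 1 ≤ q)
    (R : ℕ → ℕ → Prop) [∀ q n, Decidable (R q n)] (Q : ℕ → Prop) [DecidablePred Q] :
    ((W ×ˢ Icc 1 ⌊x⌋₊).filter (fun p : ℕ × ℕ =>
        (x / 2 < (p.1 * p.2 : ℝ) ∧ (p.1 * p.2 : ℝ) ≤ x) ∧ R p.1 p.2 ∧ Q p.2)).card ≤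
      ∑ q ∈ W, ((Icc 1 (⌊x⌋₊ / q)).filter Q).card := by
  rw [Finset.card_filter, Finset.sum_product]
  refine Finset.sum_le_sum fun q hq => ?_
  rw [← Finset.card_filter]
  refine Finset.card_le_card fun n hn => ?_
  rw [Finset.mem_filter, Finset.mem_Icc] at hn
  obtain ⟨⟨hn1, _⟩, ⟨_, hle⟩, _, hQ⟩ := hn
  rw [Finset.mem_filter, Finset.mem_Icc]
  refine ⟨⟨hn1, ?_⟩, hQ⟩
  have hq1 := hW q hq
  rw [Nat.le_div_iff_mul_le (by omega), mul_comm]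
  exact Nat.le_floor (by push_cast; exact hle)

open scoped Classical in
/-- With `Q(n'') = [∃ p prime, Y < p, p² ∣ n'']`: the number of exceptional pairs is at most
`(2x/(Y+1)) ∑_{q ∈ W} 1/q`. [folklore] -/
theorem card_pairs_window_sq_le {x : ℝ} (hx : 0 ≤ x) (W : Finset ℕ) (hW : ∀ q ∈ W, 1 ≤ q)
    (R : ℕ → ℕ → Prop) (Y : ℕ) :
    (((W ×ˢ Icc 1 ⌊x⌋₊).filter (fun p : ℕ × ℕ =>
        (x / 2 < (p.1 * p.2 : ℝ) ∧ (p.1 * p.2 : ℝ) ≤ x) ∧ R p.1 p.2 ∧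
          ∃ r : ℕ, r.Prime ∧ Y < r ∧ r ^ 2 ∣ p.2)).card : ℝ) ≤
      2 * x / ((Y : ℝ) + 1) * ∑ q ∈ W, (1 / (q : ℝ)) := by
  have h1 := card_pairs_window_le (x := x) W hW R (fun n : ℕ => ∃ p : ℕ, p.Prime ∧ Y < p ∧ p ^ 2 ∣ n)
  have h1' : (((W ×ˢ Icc 1 ⌊x⌋₊).filter (fun p : ℕ × ℕ =>
        (x / 2 < (p.1 * p.2 : ℝ) ∧ (p.1 * p.2 : ℝ) ≤ x) ∧ R p.1 p.2 ∧
          ∃ r : ℕ, r.Prime ∧ Y < r ∧ r ^ 2 ∣ p.2)).card : ℝ) ≤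
      ∑ q ∈ W, (((Icc 1 (⌊x⌋₊ / q)).filter (fun n : ℕ => ∃ p : ℕ, p.Prime ∧ Y < p ∧ p ^ 2 ∣ n)).card : ℝ) := by
    exact_mod_cast h1
  refine h1'.trans ?_
  rw [Finset.mul_sum]
  refine Finset.sum_le_sum fun q hq => ?_
  have hq1 : (1 : ℝ) ≤ q := by exact_mod_cast hW q hq
  have h2 := card_filter_exists_sq_dvd_le (⌊x⌋₊ / q) Y
  refine h2.trans ?_
  have hdiv : (((⌊x⌋₊ / q : ℕ)) : ℝ) ≤ x / q := by
    calc (((⌊x⌋₊ / q : ℕ)) : ℝ) ≤ (⌊x⌋₊ : ℝ) / q := Nat.cast_div_le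
      _ ≤ x / q := div_le_div_of_nonneg_right (Nat.floor_le hx) (by linarith)
  have hY : (0 : ℝ) < (Y : ℝ) + 1 := by positivity
  rw [div_le_iff₀ hY]
  calc 2 * (((⌊x⌋₊ / q : ℕ)) : ℝ) ≤ 2 * (x / q) := by linarith
    _ = 2 * x / ((Y : ℝ) + 1) * (1 / (q : ℝ)) * ((Y : ℝ) + 1) := by
        field_simp

end Summit.Parity.GeneralizedHardyLittlewood.FordMaynardSieveConst01651SieveConst01651
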